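import Summits.Ventures.HSemireg.WedgeHankelClassSpaceSl2Triple

/-!
# Venture HSemireg — THE RAISING OPERATOR IN CHARACTERISTIC `p`: `e^p = 0` on th-7's class space (the coefficient `(i+1)⋯(i+p)` of `e^p E_i` is divisible by `p`), `e^k E_0 = k! E_k ≠ 0` for
# `k < p`, hence **the nilpotency index of `e` is exactly `min(p, n+1)`** — uniform in `n`

HONEST FRAMING. Part of the Lean index of the computation cell `pub-hsemireg` (seat p10 gen 22, Sunday typer «UNIFORM-IN-n»).
Finite-dimensional linear algebra of endomorphisms of th-7's class space ONLY: no variety, no cohomology theory, no sheaf, no Ext group, no semiregularity map;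
nothing here says that HC / HC_CM / HC_AV holds; no Literature fact is declared or used.  Custodian versions as in `WedgeHankelSiegelIdeal` (1/3) and `WedgeHankelFrameChange`;
the dictionary (`e` = the infinitesimal shear on `Sym^n`; in characteristic `p` the shear `S` has `(S − 1)^p = S^p − 1 = 0`, matching `e^p = 0`) is QUOTED, never asserted.

WHAT IS IN THE TREE.  K27 (`WedgeHankelClassSpaceSl2Triple`): `pow_raising_spikeBasis_of_le` (`e^k E_i = (i+1).ascFactorial k • E_{i+k}`), `pow_raising_spikeBasis_eq_zero`,
`raising_pow_succ_eq_zero` (`e^{n+1} = 0`), `raising_pow_ne_zero_of_factorial`; Mathlib `Nat.factorial_dvd_ascFactorial`, `Nat.Prime.dvd_factorial`, `CharP.cast_eq_zero_iff`.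
THIS FILE (namespace `Summit.Ventures.HSemireg.Wedge.HankelFrameChange` continued; imports K27; K27's hypotheses `hE`, `hEtop`):
* §366 `ascFactorial_cast_eq_zero_of_charP` (`((m.ascFactorial p : ℕ) : K) = 0` in characteristic `p`: `p! ∣ m.ascFactorial p`), **`raising_pow_charP_eq_zero`: `e ^ p = 0`**
  (every `n`; for `p > n` this is weaker than K27's `e^{n+1} = 0`), `raising_pow_eq_zero_of_le` (`e^k = 0` for `min p (n+1) ≤ k`).
* §367 `pow_raising_spikeBasis_zero` (`e^k E_0 = k! • E_k`, `k ≤ n`), **`raising_pow_ne_zero_of_lt_charP`** (`k ≤ n`, `k < p` ⇒ `e^k ≠ 0`), and the index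
  **`raising_pow_eq_zero_iff_charP`: `e ^ k = 0 ↔ min p (n + 1) ≤ k`** (characteristic `p`, every `n`, every `k`).
NOT typed here: the lowering operator (conjugate by the swap, K30/K31), the Jordan type of `e` (blocks of length `p` and one of length `(n+1) mod p`, cf. K11/K21 for the shear);
anything Ext-side.  New names only.
-/

open Module

namespace Summit.Ventures.HSemireg.Wedge.HankelFrameChange

open Summit.Ventures.HSemireg.Wedge Summit.Ventures.HSemireg.Wedge.Kunneth Summit.Ventures.HSemireg.Wedge.Hankel
  Summit.Ventures.HSemireg.Wedge.BasisFree Summit.Ventures.HSemireg.Wedge.HankelSiegel Summit.Ventures.HSemireg.Wedge.HankelSiegelIdeal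
  Summit.Ventures.HSemireg.Wedge.KunnethKernel Summit.Ventures.HSemireg.Wedge.HankelRankOne Summit.Ventures.HSemireg.Wedge.KernelDuality

variable (K : Type*) [Field K] {n : ℕ}

/-! ## §366. `e^p = 0` in characteristic `p` -/

/-- in characteristic `p`, `m (m+1) ⋯ (m+p−1) = 0` in `K` (`p!` divides every product of `p` consecutive integers). -/
theorem ascFactorial_cast_eq_zero_of_charP (p : ℕ) [Fact p.Prime] [CharP K p] (m : ℕ) : ((m.ascFactorial p : ℕ) : K) = 0 := by
  rw [CharP.cast_eq_zero_iff K p]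
  exact dvd_trans (Nat.dvd_factorial (Fact.out : p.Prime).pos le_rfl) (Nat.factorial_dvd_ascFactorial m p)

section Triple

variable {e : Module.End K (spikeSpan K n)}
  (hE : ∀ (i : Fin (n + 1)) (hi : (i : ℕ) < n), e (spikeBasis K n i) = (((i : ℕ) : K) + 1) • spikeBasis K n ⟨(i : ℕ) + 1, by omega⟩) (hEtop : e (spikeBasis K n (Fin.last n)) = 0)

include hE hEtop in
/-- **`e ^ p = 0` in characteristic `p`** (every `n`): on `E_i` with `i + p ≤ n` the coefficient `(i+1)⋯(i+p)` vanishes, and `e^p E_i = 0` anyway when `i + p > n`. -/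
theorem raising_pow_charP_eq_zero (p : ℕ) [Fact p.Prime] [CharP K p] : e ^ p = 0 := by
  refine (spikeBasis K n).ext fun i => ?_
  rw [LinearMap.zero_apply]
  by_cases hip : (i : ℕ) + p ≤ n
  · rw [pow_raising_spikeBasis_of_le K hE i hip, ascFactorial_cast_eq_zero_of_charP K p, zero_smul]
  · exact pow_raising_spikeBasis_eq_zero K hE hEtop i (by omega)

include hE hEtop in
/-- `e ^ k = 0` as soon as `min p (n+1) ≤ k` (characteristic `p`). -/
theorem raising_pow_eq_zero_of_le (p : ℕ) [Fact p.Prime] [CharP K p] {k : ℕ} (hk : min p (n + 1) ≤ k) : e ^ k = 0 := by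
  by_cases hpk : p ≤ k
  · rw [← Nat.sub_add_cancel hpk, pow_add, raising_pow_charP_eq_zero K hE hEtop p, mul_zero]
  · have hnk : n + 1 ≤ k := by omega
    rw [← Nat.sub_add_cancel hnk, pow_add, raising_pow_succ_eq_zero K hE hEtop, mul_zero]

/-! ## §367. The nilpotency index is `min(p, n+1)` -/

include hE in
/-- `e^k E_0 = k! • E_k` for `k ≤ n`. -/
theorem pow_raising_spikeBasis_zero {k : ℕ} (hk : k ≤ n) : (e ^ k) (spikeBasis K n 0) = ((k.factorial : ℕ) : K) • spikeBasis K n ⟨k, by omega⟩ := by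
  rw [pow_raising_spikeBasis_of_le K hE 0 (k := k) (by simp only [Fin.val_zero]; omega)]
  have e1 : (⟨((0 : Fin (n + 1)) : ℕ) + k, by simp only [Fin.val_zero]; omega⟩ : Fin (n + 1)) = ⟨k, by omega⟩ := Fin.ext (by simp only [Fin.val_zero]; omega)
  rw [e1, show ((((0 : Fin (n + 1)) : ℕ) + 1).ascFactorial k : ℕ) = k.factorial by rw [Fin.val_zero, zero_add, Nat.one_ascFactorial]]

include hE in
/-- **in characteristic `p`, `e^k ≠ 0` for `k ≤ n` with `k < p`** (`e^k E_0 = k! • E_k` and `p ∤ k!`). -/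
theorem raising_pow_ne_zero_of_lt_charP (p : ℕ) [Fact p.Prime] [CharP K p] {k : ℕ} (hkn : k ≤ n) (hkp : k < p) : e ^ k ≠ 0 := by
  intro h0
  have h := pow_raising_spikeBasis_zero K hE hkn
  rw [h0, LinearMap.zero_apply, eq_comm, smul_eq_zero] at h
  rcases h with h | h
  · rw [CharP.cast_eq_zero_iff K p, (Fact.out : p.Prime).dvd_factorial] at h
    omega
  · exact (spikeBasis K n).ne_zero _ h

include hE hEtop in
/-- **THE NILPOTENCY INDEX OF THE RAISING OPERATOR IN CHARACTERISTIC `p` IS `min(p, n+1)`: `e ^ k = 0 ↔ min p (n+1) ≤ k`** (every `n`, every `k`). -/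
theorem raising_pow_eq_zero_iff_charP (p : ℕ) [Fact p.Prime] [CharP K p] (k : ℕ) : e ^ k = 0 ↔ min p (n + 1) ≤ k := by
  constructor
  · intro h
    by_contra hk
    exact raising_pow_ne_zero_of_lt_charP K hE p (k := k) (by omega) (by omega) h
  · exact raising_pow_eq_zero_of_le K hE hEtop p

end Triple

end Summit.Ventures.HSemireg.Wedge.HankelFrameChange
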